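import Literature.InformationTheory.QuantumCodes.QuaternaryMacWilliams
import HarnessLib

/-!
# The refined weight enumerator of an additive code with respect to a codeword, and its MacWilliams identity (CRSS 1998 §7 (ii))

Topic `Literature/InformationTheory/QuantumCodes` (venture QEC, cell `qec`, row 06 / rung X1). To eliminate `[[18,12,3]]`
Calderbank–Rains–Shor–Sloane refine the weight enumerator with respect to a fixed codeword `u₀` of weight `w₀`:
«We define the refined weight enumerator of `C` with respect to `u₀` to be
`R_C(x₀,x₁,y₀,y₁,y₂) = Σ_{u∈C} x₀^{6−a(u)} x₁^{a(u)} y₀^{12−b(u)−c(u)} y₁^{b(u)} y₂^{c(u)}`, where `a(u)` is the weight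
of `u` in the first 6 coordinates [off the support of `u₀`], and `b(u)` (resp. `c(u)`) is the number of `1`'s
(resp. `ω`'s or `ω̄`'s) in `u` in the last 12 coordinates [on the support of `u₀ = 0⁶1¹²`: letters equal to, resp.
nonzero and different from, the letter of `u₀`]. The conditions on `C` imply that `c(u) ≡ 0 (mod 2)`,
`(a(u+u₀), b(u+u₀), c(u+u₀)) = (a(u), 12 − b(u) − c(u), c(u))`, and
`R_{C⊥} = (1/|C|) R_C(x₀+3x₁, x₀−x₁, y₀+y₁+2y₂, y₀+y₁−2y₂, y₀−y₁)`.» [CalderbankEtAl1998, §7 (ii), printed p. 28].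

This file proves these three facts for EVERY `n`, every subspace `S̄ ≤ Ē = 𝔽₂²ⁿ` (binary-symplectic language of the
tree, `SympVec n`, `letters`) and every reference vector `u₀ ∈ Ē` (no normal form `0⁶1¹²` is needed: the classes are
defined coordinatewise relative to the letters of `u₀`):

* `offWt u₀ v = a(v)`, `sameCnt u₀ v = b(v)`, `otherCnt u₀ v = c(v)`; `sympWeight v = a + b + c`;
* `card_mul_refEnum_sympDual` — the refined MacWilliams identity `|C| · R_{C⊥}(x) = R_C(T x)` over any commutative
  ring (character sum over `S̄` + a three-class one-letter generating identity, exactly as Thm. 5 in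
  `QuaternaryMacWilliams.lean`);
* `otherCnt_even_of_sympInner_eq_zero` — `c(v) ≡ (v,u₀) (mod 2)`, so `c` is even on `C⊥ ∋ v` when `u₀ ∈ C`;
* `offWt_add_self`/`sameCnt_add_self`/`otherCnt_add_self` — the translation rule for `v + u₀`;
* the refined DISTRIBUTION `refDist S u₀ a b c = #{v ∈ C : (a,b,c)(v) = (a,b,c)}` with `refEnum` as its generating
  polynomial, its marginal onto the weight distribution, `refDist S u₀ 0 0 0 = 1`, `refDist S u₀ 0 w₀ 0 = 1` for
  `u₀ ∈ C`, and the translation symmetry `refDist S u₀ a b c = refDist S u₀ a (w₀−b−c) c`.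

Deliberately NOT here: the linear program built from these facts and its certificates (`RefinedLPBoundAdditive.lean`,
Summits-side `RefinedIPCertificate.lean`); any specific `(n,k,d)`. HONEST FRAMING: identities about enumerators;
nothing here certifies a distance. Reference: [CalderbankEtAl1998] A. R. Calderbank, E. M. Rains, P. W. Shor,
N. J. A. Sloane, IEEE Trans. Inform. Theory 44 (1998) 1369–1387 = arXiv:quant-ph/9608006v5, §7 (ii) (printed p. 28,
held text chunk p0029 L26–38).
-/

namespace Literature.InformationTheory.QuantumCodes

open Finset

variable {n : ℕ}

/-- `letters v i = (aᵢ, bᵢ)` (definitional). [folklore] -/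
private theorem letters_apply' (v : SympVec n) (i : Fin n) : letters n v i = (v.1 i, v.2 i) := rfl

/-- `letters (v + u) i = letters v i + letters u i`. [folklore] -/
private theorem letters_add (v u : SympVec n) (i : Fin n) : letters n (v + u) i = letters n v i + letters n u i := rfl

/-! ### 1. The three classes of a coordinate relative to `u₀` and the counts `a, b, c` -/

/-- `a(v)`: the weight of `v` OFF the support of `u₀` (coordinates `i` with `(u₀)ᵢ = 0`, `vᵢ ≠ 0`).
[cite: CalderbankEtAl1998, §7 (ii) (printed p. 28: «a(u) is the weight of u in the first 6 coordinates»)] -/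
def offWt (u₀ v : SympVec n) : ℕ := #{i | letters n u₀ i = 0 ∧ letters n v i ≠ 0}

/-- `b(v)`: the number of coordinates ON the support of `u₀` where `v` carries the SAME letter as `u₀`.
[cite: CalderbankEtAl1998, §7 (ii) (printed p. 28: «b(u) … is the number of 1's … in the last 12 coordinates», u₀ = 0⁶1¹²)] -/
def sameCnt (u₀ v : SympVec n) : ℕ := #{i | letters n u₀ i ≠ 0 ∧ letters n v i = letters n u₀ i}

/-- `c(v)`: the number of coordinates ON the support of `u₀` where `v` carries a nonzero letter DIFFERENT from that
of `u₀`. [cite: CalderbankEtAl1998, §7 (ii) (printed p. 28: «c(u) is the number of ω's or ω̄'s in u in the last 12 coordinates»)] -/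
def otherCnt (u₀ v : SympVec n) : ℕ :=
  #{i | letters n u₀ i ≠ 0 ∧ letters n v i ≠ 0 ∧ letters n v i ≠ letters n u₀ i}

/-- The three on-support classes and the off-support zero class partition the coordinates:
`#{i : (u₀)ᵢ ≠ 0, vᵢ = 0} + b(v) + c(v) = wt u₀`. [cite: CalderbankEtAl1998, §7 (ii) (printed p. 28)] -/
theorem card_onZero_add (u₀ v : SympVec n) :
    #{i | letters n u₀ i ≠ 0 ∧ letters n v i = 0} + sameCnt u₀ v + otherCnt u₀ v = sympWeight u₀ := by
  classical
  unfold sameCnt otherCnt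
  rw [← card_filter_letters_ne_zero u₀, ← Finset.card_union_of_disjoint, ← Finset.card_union_of_disjoint]
  · congr 1; ext i
    simp only [mem_union, mem_filter, mem_univ, true_and]
    constructor
    · rintro ((⟨h, _⟩ | ⟨h, _⟩) | ⟨h, _⟩) <;> exact h
    · intro h
      by_cases hv : letters n v i = 0
      · exact Or.inl (Or.inl ⟨h, hv⟩)
      · by_cases hs : letters n v i = letters n u₀ i
        · exact Or.inl (Or.inr ⟨h, hs⟩)
        · exact Or.inr ⟨h, hv, hs⟩
  · rw [Finset.disjoint_left]
    rintro i hi hi'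
    simp only [mem_union, mem_filter, mem_univ, true_and] at hi hi'
    rcases hi with ⟨h0, hv⟩ | ⟨h0, hs⟩
    · exact hi'.2.1 hv
    · exact hi'.2.2 hs
  · rw [Finset.disjoint_left]
    rintro i hi hi'
    simp only [mem_filter, mem_univ, true_and] at hi hi'
    exact hi'.1 (hi'.2 ▸ hi.2)

/-- `#{i : (u₀)ᵢ = 0, vᵢ = 0} + a(v) = n − wt u₀`. [cite: CalderbankEtAl1998, §7 (ii) (printed p. 28)] -/
theorem card_offZero_add (u₀ v : SympVec n) :
    #{i | letters n u₀ i = 0 ∧ letters n v i = 0} + offWt u₀ v = n - sympWeight u₀ := by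
  classical
  unfold offWt
  rw [← card_filter_letters_eq_zero u₀, ← Finset.card_union_of_disjoint]
  · congr 1; ext i
    simp only [mem_union, mem_filter, mem_univ, true_and]
    constructor
    · rintro (⟨h, _⟩ | ⟨h, _⟩) <;> exact h
    · intro h; by_cases hv : letters n v i = 0
      · exact Or.inl ⟨h, hv⟩
      · exact Or.inr ⟨h, hv⟩
  · rw [Finset.disjoint_left]
    rintro i hi hi'
    simp only [mem_filter, mem_univ, true_and] at hi hi'
    exact hi'.2 hi.2

/-- `wt v = a(v) + b(v) + c(v)`. [cite: CalderbankEtAl1998, §7 (ii) (printed p. 28)] -/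
theorem sympWeight_eq_offWt_add (u₀ v : SympVec n) :
    sympWeight v = offWt u₀ v + sameCnt u₀ v + otherCnt u₀ v := by
  classical
  unfold offWt sameCnt otherCnt
  rw [← card_filter_letters_ne_zero v, ← Finset.card_union_of_disjoint, ← Finset.card_union_of_disjoint]
  · congr 1; ext i
    simp only [mem_union, mem_filter, mem_univ, true_and]
    constructor
    · intro hv
      by_cases h0 : letters n u₀ i = 0
      · exact Or.inl (Or.inl ⟨h0, hv⟩)
      · by_cases hs : letters n v i = letters n u₀ i
        · exact Or.inl (Or.inr ⟨h0, hs⟩)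
        · exact Or.inr ⟨h0, hv, hs⟩
    · rintro ((⟨_, hv⟩ | ⟨h0, hs⟩) | ⟨_, hv, _⟩)
      · exact hv
      · rw [hs]; exact h0
      · exact hv
  · rw [Finset.disjoint_left]
    rintro i hi hi'
    simp only [mem_union, mem_filter, mem_univ, true_and] at hi hi'
    rcases hi with ⟨h0, _⟩ | ⟨_, hs⟩
    · exact hi'.1 h0
    · exact hi'.2.2 hs
  · rw [Finset.disjoint_left]
    rintro i hi hi'
    simp only [mem_filter, mem_univ, true_and] at hi hi'
    exact hi'.1 hi.1

/-- `a(v) ≤ n − wt u₀`. [cite: CalderbankEtAl1998, §7 (ii) (printed p. 28)] -/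
theorem offWt_le (u₀ v : SympVec n) : offWt u₀ v ≤ n - sympWeight u₀ := by
  have := card_offZero_add u₀ v; omega

/-- `b(v) + c(v) ≤ wt u₀`. [cite: CalderbankEtAl1998, §7 (ii) (printed p. 28)] -/
theorem sameCnt_add_otherCnt_le (u₀ v : SympVec n) : sameCnt u₀ v + otherCnt u₀ v ≤ sympWeight u₀ := by
  have := card_onZero_add u₀ v; omega

/-! ### 2. The refined enumerator and the one-letter generating identity -/

variable {R : Type*} [CommRing R]

/-- The one-letter monomial relative to the reference letter `r = (u₀)ᵢ`: off the support (`r = 0`) the letter `b`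
contributes `x₀` (identity) or `x₁`; on the support it contributes `y₀` (identity), `y₁` (`b = r`) or `y₂` (other).
[cite: CalderbankEtAl1998, §7 (ii) (printed p. 28, definition of `R_C`)] -/
def locRef (r b : ZMod 2 × ZMod 2) (x₀ x₁ y₀ y₁ y₂ : R) : R :=
  if r = 0 then (if b = 0 then x₀ else x₁) else (if b = 0 then y₀ else if b = r then y₁ else y₂)

open scoped Classical in
/-- **The refined weight enumerator of `C` with respect to `u₀`**,
`R_C(x₀,x₁,y₀,y₁,y₂) = Σ_{v ∈ C} x₀^{(n−w₀)−a(v)} x₁^{a(v)} y₀^{w₀−b(v)−c(v)} y₁^{b(v)} y₂^{c(v)}` (`w₀ = wt u₀`).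
[cite: CalderbankEtAl1998, §7 (ii) (printed p. 28)] -/
noncomputable def refEnum (S : Submodule (ZMod 2) (SympVec n)) (u₀ : SympVec n) (x₀ x₁ y₀ y₁ y₂ : R) : R :=
  ∑ v ∈ codeWords S, x₀ ^ (n - sympWeight u₀ - offWt u₀ v) * x₁ ^ offWt u₀ v *
    (y₀ ^ (sympWeight u₀ - sameCnt u₀ v - otherCnt u₀ v) * y₁ ^ sameCnt u₀ v * y₂ ^ otherCnt u₀ v)

/-- The one-letter monomial as a product of powers with `0/1` exponents (one indicator per class). [folklore] -/
private theorem locRef_eq_pow (r b : ZMod 2 × ZMod 2) (x₀ x₁ y₀ y₁ y₂ : R) :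
    locRef r b x₀ x₁ y₀ y₁ y₂ =
      x₀ ^ (if r = 0 ∧ b = 0 then 1 else 0) * x₁ ^ (if r = 0 ∧ b ≠ 0 then 1 else 0) *
        (y₀ ^ (if r ≠ 0 ∧ b = 0 then 1 else 0) * y₁ ^ (if r ≠ 0 ∧ b = r then 1 else 0) *
          y₂ ^ (if r ≠ 0 ∧ b ≠ 0 ∧ b ≠ r then 1 else 0)) := by
  unfold locRef
  by_cases hr : r = 0
  · subst hr
    by_cases hb : b = 0 <;> simp [hb]
  · by_cases hb : b = 0
    · subst hb; simp [hr, Ne.symm hr]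
    · by_cases hbr : b = r <;> simp [hr, hb, hbr]

/-- The refined monomial of `v` is the product of its one-letter monomials.
[cite: CalderbankEtAl1998, §7 (ii) (printed p. 28)] -/
theorem prod_locRef (u₀ v : SympVec n) (x₀ x₁ y₀ y₁ y₂ : R) :
    ∏ i, locRef (letters n u₀ i) (letters n v i) x₀ x₁ y₀ y₁ y₂ =
      x₀ ^ (n - sympWeight u₀ - offWt u₀ v) * x₁ ^ offWt u₀ v *
        (y₀ ^ (sympWeight u₀ - sameCnt u₀ v - otherCnt u₀ v) * y₁ ^ sameCnt u₀ v * y₂ ^ otherCnt u₀ v) := by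
  classical
  simp only [locRef_eq_pow, prod_mul_distrib, Finset.prod_pow_eq_pow_sum, Finset.sum_boole, Nat.cast_id]
  have e1 : #{i | letters n u₀ i = 0 ∧ letters n v i = 0} = n - sympWeight u₀ - offWt u₀ v := by
    have := card_offZero_add u₀ v; omega
  have e3 : #{i | letters n u₀ i ≠ 0 ∧ letters n v i = 0} = sympWeight u₀ - sameCnt u₀ v - otherCnt u₀ v := by
    have := card_onZero_add u₀ v; omega
  rw [e1, e3]
  rfl

/-- **The three-class one-letter generating identity.** For letters `a` (of `v`) and `r` (of `u₀`):
`Σ_{b ∈ 𝔽₂²} (−1)^{(a,b)} · locRef r b (x₀,x₁,y₀,y₁,y₂) = locRef r a (x₀+3x₁, x₀−x₁, y₀+y₁+2y₂, y₀+y₁−2y₂, y₀−y₁)`: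
off the support the sums `x₀ + 3x₁` / `x₀ − x₁` of Thm. 5; on the support, `y₀ + y₁ + 2y₂` if `a = 0` (everything
commutes), `y₀ + y₁ − 2y₂` if `a = r` (the two other letters anticommute), `y₀ − y₁` if `a ∉ {0, r}` (`r`
anticommutes, the two others cancel). [cite: CalderbankEtAl1998, §7 (ii) (printed p. 28: `R_{C⊥} = (1/|C|) R_C(x₀+3x₁, x₀−x₁, y₀+y₁+2y₂, y₀+y₁−2y₂, y₀−y₁)`)] -/
theorem sum_locSign_mul_locRef (a r : ZMod 2 × ZMod 2) (x₀ x₁ y₀ y₁ y₂ : R) :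
    ∑ b : ZMod 2 × ZMod 2, (z2Sign (locInner a b) : R) * locRef r b x₀ x₁ y₀ y₁ y₂ =
      locRef r a (x₀ + 3 * x₁) (x₀ - x₁) (y₀ + y₁ + 2 * y₂) (y₀ + y₁ - 2 * y₂) (y₀ - y₁) := by
  obtain ⟨a₁, a₂⟩ := a
  obtain ⟨r₁, r₂⟩ := r
  rw [Fintype.sum_prod_type]
  have h4 : ∀ f : ZMod 2 → R, ∑ t : ZMod 2, f t = f 0 + f 1 := fun f => Fin.sum_univ_two f
  simp only [h4, locInner, locRef, z2Sign, Prod.mk_eq_zero, Prod.mk.injEq]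
  rcases (by decide : ∀ t : ZMod 2, t = 0 ∨ t = 1) a₁ with h₁ | h₁ <;>
  rcases (by decide : ∀ t : ZMod 2, t = 0 ∨ t = 1) a₂ with h₂ | h₂ <;>
  rcases (by decide : ∀ t : ZMod 2, t = 0 ∨ t = 1) r₁ with h₃ | h₃ <;>
  rcases (by decide : ∀ t : ZMod 2, t = 0 ∨ t = 1) r₂ with h₄ | h₄ <;>
  subst h₁ h₂ h₃ h₄ <;> simp +decide <;> ring_nf

/-- **The refined generating identity** (one row of the refined MacWilliams transform): for all `u₀, v ∈ Ē`,
`Σ_{w ∈ Ē} (−1)^{(v,w)} ∏ᵢ locRef (u₀)ᵢ wᵢ (x) = ∏ᵢ locRef (u₀)ᵢ vᵢ (T x)`,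
`T x = (x₀+3x₁, x₀−x₁, y₀+y₁+2y₂, y₀+y₁−2y₂, y₀−y₁)`. [cite: CalderbankEtAl1998, §7 (ii) (printed p. 28)] -/
theorem sum_sympSign_mul_prod_locRef (u₀ v : SympVec n) (x₀ x₁ y₀ y₁ y₂ : R) :
    ∑ w : SympVec n, (sympSign v w : R) * ∏ i, locRef (letters n u₀ i) (letters n w i) x₀ x₁ y₀ y₁ y₂ =
      ∏ i, locRef (letters n u₀ i) (letters n v i)
        (x₀ + 3 * x₁) (x₀ - x₁) (y₀ + y₁ + 2 * y₂) (y₀ + y₁ - 2 * y₂) (y₀ - y₁) := by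
  let g : Fin n → ZMod 2 × ZMod 2 → R := fun i b =>
    (z2Sign (locInner (letters n v i) b) : R) * locRef (letters n u₀ i) b x₀ x₁ y₀ y₁ y₂
  have hsummand : ∀ w : SympVec n,
      (sympSign v w : R) * ∏ i, locRef (letters n u₀ i) (letters n w i) x₀ x₁ y₀ y₁ y₂ =
        ∏ i, g i (letters n w i) := by
    intro w
    rw [sympSign_eq_prod, Int.cast_prod, ← prod_mul_distrib]
  rw [Fintype.sum_congr _ _ hsummand]
  rw [Fintype.sum_equiv (letters n) (fun w => ∏ i, g i (letters n w i)) (fun f => ∏ i, g i (f i))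
    (fun w => rfl), ← Fintype.prod_sum g]
  simp only [g, sum_locSign_mul_locRef]

/-- `refEnum` as a sum of letter products. [cite: CalderbankEtAl1998, §7 (ii) (printed p. 28)] -/
theorem refEnum_eq_sum_prod (S : Submodule (ZMod 2) (SympVec n)) (u₀ : SympVec n) (x₀ x₁ y₀ y₁ y₂ : R) :
    refEnum S u₀ x₀ x₁ y₀ y₁ y₂ =
      ∑ v ∈ codeWords S, ∏ i, locRef (letters n u₀ i) (letters n v i) x₀ x₁ y₀ y₁ y₂ := by
  unfold refEnum
  exact Finset.sum_congr rfl fun v _ => (prod_locRef u₀ v x₀ x₁ y₀ y₁ y₂).symm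

open scoped Classical in
/-- **The refined MacWilliams identity (CRSS §7 (ii)).** For every subspace `S̄ ≤ Ē`, every `u₀ ∈ Ē` and all
`x₀,x₁,y₀,y₁,y₂` in a commutative ring:
`|C| · R_{C⊥}(x₀,x₁,y₀,y₁,y₂) = R_C(x₀+3x₁, x₀−x₁, y₀+y₁+2y₂, y₀+y₁−2y₂, y₀−y₁)` («`R_{C⊥} = (1/|C|) R_C(…)`»,
cleared of the denominator; `C = S̄`, `C⊥ = S̄⊥` its symplectic dual). Column: PROVED (character sum over `S̄` + the
three-class one-letter identity). [cite: CalderbankEtAl1998, §7 (ii) (printed p. 28)] -/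
theorem card_mul_refEnum_sympDual (S : Submodule (ZMod 2) (SympVec n)) (u₀ : SympVec n) (x₀ x₁ y₀ y₁ y₂ : R) :
    (#(codeWords S) : R) * refEnum (sympDual S) u₀ x₀ x₁ y₀ y₁ y₂ =
      refEnum S u₀ (x₀ + 3 * x₁) (x₀ - x₁) (y₀ + y₁ + 2 * y₂) (y₀ + y₁ - 2 * y₂) (y₀ - y₁) := by
  classical
  rw [refEnum_eq_sum_prod, refEnum_eq_sum_prod]
  -- expand the right-hand side by the generating identity and swap the sums
  rw [← Finset.sum_congr rfl fun v _ => sum_sympSign_mul_prod_locRef u₀ v x₀ x₁ y₀ y₁ y₂, Finset.sum_comm]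
  -- the character sum collapses the inner sum onto `S̄⊥`
  rw [Finset.mul_sum, ← Finset.sum_filter_add_sum_filter_not univ (· ∈ sympDual S)]
  have h1 : ∀ w ∈ univ.filter (· ∈ sympDual S),
      ∑ v ∈ codeWords S, (sympSign v w : R) * ∏ i, locRef (letters n u₀ i) (letters n w i) x₀ x₁ y₀ y₁ y₂ =
        (#(codeWords S) : R) * ∏ i, locRef (letters n u₀ i) (letters n w i) x₀ x₁ y₀ y₁ y₂ := by
    intro w hw
    rw [← Finset.sum_mul, ← Int.cast_sum, codeWords, sum_sympSign_eq S w, if_pos (mem_filter.1 hw).2]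
    simp
  have h0 : ∀ w ∈ univ.filter (fun w => ¬ w ∈ sympDual S),
      ∑ v ∈ codeWords S, (sympSign v w : R) * ∏ i, locRef (letters n u₀ i) (letters n w i) x₀ x₁ y₀ y₁ y₂ = 0 := by
    intro w hw
    rw [← Finset.sum_mul, ← Int.cast_sum, codeWords, sum_sympSign_eq S w, if_neg (mem_filter.1 hw).2]
    simp
  rw [Finset.sum_congr rfl h1, Finset.sum_congr rfl h0, sum_const_zero, add_zero]
  rfl

/-! ### 3. Parity of `c` and the translation rule -/

/-- The one-letter fact behind «`c(u) ≡ 0 (mod 2)`»: for a nonzero reference letter `r`, the letter `a` anticommutes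
with `r` exactly when `a ∉ {0, r}`; for `r = 0` never. [cite: CalderbankEtAl1998, §7 (ii) (printed p. 28)] -/
theorem locInner_eq_ite (a r : ZMod 2 × ZMod 2) :
    locInner a r = if r ≠ 0 ∧ a ≠ 0 ∧ a ≠ r then 1 else 0 := by
  revert a r
  decide

/-- **`c(v) ≡ (v, u₀) (mod 2)`**: the symplectic product with `u₀` counts, mod 2, the coordinates where `v` carries
a nonzero letter different from that of `u₀`. [cite: CalderbankEtAl1998, §7 (ii) (printed p. 28: «The conditions on C imply that c(u) ≡ 0 (mod 2)»)] -/
theorem natCast_otherCnt (u₀ v : SympVec n) : ((otherCnt u₀ v : ℕ) : ZMod 2) = sympInner v u₀ := by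
  classical
  rw [sympInner_eq_sum_locInner, otherCnt, Finset.card_filter]
  push_cast
  refine Finset.sum_congr rfl fun i _ => ?_
  rw [locInner_eq_ite]

/-- If `(v, u₀) = 0` (in particular for `v ∈ C⊥` and `u₀ ∈ C`), then `c(v)` is even.
[cite: CalderbankEtAl1998, §7 (ii) (printed p. 28)] -/
theorem otherCnt_even_of_sympInner_eq_zero {u₀ v : SympVec n} (h : sympInner v u₀ = 0) : Even (otherCnt u₀ v) := by
  rw [← ZMod.natCast_eq_zero_iff_even, natCast_otherCnt, h]

/-- The one-letter translation rule: relative to a nonzero reference letter `r`, adding `r` swaps the classes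
«identity» and «same» and fixes «other»; off the support nothing changes. [cite: CalderbankEtAl1998, §7 (ii) (printed p. 28)] -/
private theorem letter_add_cases (a r : ZMod 2 × ZMod 2) :
    (a + r = 0 ↔ a = r) ∧ (a + r = r ↔ a = 0) := by
  constructor
  · constructor
    · intro h
      have : a = -r := eq_neg_of_add_eq_zero_left h
      rw [this]; ext <;> simp [ZMod.neg_eq_self_mod_two]
    · rintro rfl; ext <;> exact CharTwo.add_self_eq_zero _
  · constructor
    · intro h; simpa using congrArg (· - r) h
    · rintro rfl; simp

/-- `a(v + u₀) = a(v)`. [cite: CalderbankEtAl1998, §7 (ii) (printed p. 28: «(a(u+u₀), b(u+u₀), c(u+u₀)) = (a(u), 12−b(u)−c(u), c(u))»)] -/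
theorem offWt_add_self (u₀ v : SympVec n) : offWt u₀ (v + u₀) = offWt u₀ v := by
  unfold offWt; congr 1; ext i
  simp only [mem_filter, mem_univ, true_and, letters_add]
  constructor
  · rintro ⟨h0, hv⟩; rw [h0, add_zero] at hv; exact ⟨h0, hv⟩
  · rintro ⟨h0, hv⟩; refine ⟨h0, ?_⟩; rw [h0, add_zero]; exact hv

/-- `c(v + u₀) = c(v)`. [cite: CalderbankEtAl1998, §7 (ii) (printed p. 28)] -/
theorem otherCnt_add_self (u₀ v : SympVec n) : otherCnt u₀ (v + u₀) = otherCnt u₀ v := by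
  unfold otherCnt; congr 1; ext i
  simp only [mem_filter, mem_univ, true_and, letters_add, ne_eq]
  have h := letter_add_cases (letters n v i) (letters n u₀ i)
  rw [h.1, h.2]
  tauto

/-- `b(v + u₀) = wt u₀ − b(v) − c(v)` (on the support, «same» ↔ «identity»).
[cite: CalderbankEtAl1998, §7 (ii) (printed p. 28)] -/
theorem sameCnt_add_self (u₀ v : SympVec n) :
    sameCnt u₀ (v + u₀) = sympWeight u₀ - sameCnt u₀ v - otherCnt u₀ v := by
  have hpart := card_onZero_add u₀ v
  suffices h : sameCnt u₀ (v + u₀) = #{i | letters n u₀ i ≠ 0 ∧ letters n v i = 0} by omega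
  unfold sameCnt; congr 1; ext i
  simp only [mem_filter, mem_univ, true_and, letters_add, ne_eq]
  rw [(letter_add_cases (letters n v i) (letters n u₀ i)).2]

/-! ### 4. The refined distribution -/

open scoped Classical in
/-- **The refined weight distribution** of `C` with respect to `u₀`: the number of `v ∈ C` with
`(a(v), b(v), c(v)) = (a, b, c)` (the coefficients of `R_C`). [cite: CalderbankEtAl1998, §7 (ii) (printed p. 28)] -/
noncomputable def refDist (S : Submodule (ZMod 2) (SympVec n)) (u₀ : SympVec n) (a b c : ℕ) : ℕ :=
  #((codeWords S).filter fun v => offWt u₀ v = a ∧ sameCnt u₀ v = b ∧ otherCnt u₀ v = c)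

open scoped Classical in
/-- Summing a function of `(a,b,c)(v)` over the code, fibrewise over the box `a ≤ n − w₀`, `b ≤ w₀`, `c ≤ w₀`.
[cite: CalderbankEtAl1998, §7 (ii) (printed p. 28)] -/
theorem sum_codeWords_eq_sum_refDist {M : Type*} [AddCommMonoid M] (S : Submodule (ZMod 2) (SympVec n))
    (u₀ : SympVec n) (f : ℕ → ℕ → ℕ → M) :
    ∑ v ∈ codeWords S, f (offWt u₀ v) (sameCnt u₀ v) (otherCnt u₀ v) =
      ∑ a ∈ range (n - sympWeight u₀ + 1), ∑ b ∈ range (sympWeight u₀ + 1), ∑ c ∈ range (sympWeight u₀ + 1),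
        refDist S u₀ a b c • f a b c := by
  classical
  have hR : (∑ a ∈ range (n - sympWeight u₀ + 1), ∑ b ∈ range (sympWeight u₀ + 1),
      ∑ c ∈ range (sympWeight u₀ + 1), refDist S u₀ a b c • f a b c) =
      ∑ p ∈ (range (n - sympWeight u₀ + 1) ×ˢ range (sympWeight u₀ + 1)) ×ˢ range (sympWeight u₀ + 1),
        refDist S u₀ p.1.1 p.1.2 p.2 • f p.1.1 p.1.2 p.2 := by
    rw [Finset.sum_product, Finset.sum_product]
  rw [hR, ← Finset.sum_fiberwise_of_maps_to (s := codeWords S)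
    (t := (range (n - sympWeight u₀ + 1) ×ˢ range (sympWeight u₀ + 1)) ×ˢ range (sympWeight u₀ + 1))
    (g := fun v => ((offWt u₀ v, sameCnt u₀ v), otherCnt u₀ v))
    (fun v _ => by
      have h1 := offWt_le u₀ v
      have h2 := sameCnt_add_otherCnt_le u₀ v
      simp only [mem_product, mem_range]
      omega)]
  refine Finset.sum_congr rfl fun p _ => ?_
  rw [Finset.sum_congr rfl fun v hv => by
    rw [show f (offWt u₀ v) (sameCnt u₀ v) (otherCnt u₀ v) = f p.1.1 p.1.2 p.2 by
      rw [← (mem_filter.1 hv).2]],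
    sum_const]
  congr 1
  unfold refDist
  congr 1; ext v
  simp only [mem_filter, Prod.ext_iff, and_assoc]

/-- **`R_C` is the generating polynomial of the refined distribution**:
`R_C(x) = Σ_{a,b,c} refDist(a,b,c) · x₀^{(n−w₀)−a} x₁^a y₀^{w₀−b−c} y₁^b y₂^c` (sum over the box).
[cite: CalderbankEtAl1998, §7 (ii) (printed p. 28)] -/
theorem refEnum_eq_sum_refDist (S : Submodule (ZMod 2) (SympVec n)) (u₀ : SympVec n) (x₀ x₁ y₀ y₁ y₂ : R) :
    refEnum S u₀ x₀ x₁ y₀ y₁ y₂ =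
      ∑ a ∈ range (n - sympWeight u₀ + 1), ∑ b ∈ range (sympWeight u₀ + 1), ∑ c ∈ range (sympWeight u₀ + 1),
        (refDist S u₀ a b c : R) * (x₀ ^ (n - sympWeight u₀ - a) * x₁ ^ a *
          (y₀ ^ (sympWeight u₀ - b - c) * y₁ ^ b * y₂ ^ c)) := by
  unfold refEnum
  rw [sum_codeWords_eq_sum_refDist S u₀ (fun a b c => x₀ ^ (n - sympWeight u₀ - a) * x₁ ^ a *
    (y₀ ^ (sympWeight u₀ - b - c) * y₁ ^ b * y₂ ^ c))]
  simp only [nsmul_eq_mul]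

/-- **Marginal**: summing the refined distribution over `a + b + c = j` gives the weight distribution `A_j`.
[cite: CalderbankEtAl1998, §7 (ii) (printed p. 28)] -/
theorem sum_refDist_eq_wtDist (S : Submodule (ZMod 2) (SympVec n)) (u₀ : SympVec n) (j : ℕ) :
    ∑ a ∈ range (n - sympWeight u₀ + 1), ∑ b ∈ range (sympWeight u₀ + 1), ∑ c ∈ range (sympWeight u₀ + 1),
      (if a + b + c = j then refDist S u₀ a b c else 0) = wtDist S j := by
  classical
  have h := sum_codeWords_eq_sum_refDist S u₀ (fun a b c => if a + b + c = j then (1 : ℕ) else 0)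
  simp only [smul_eq_mul, mul_ite, mul_one, mul_zero] at h
  rw [← h, Finset.sum_boole, wtDist]
  exact congrArg Finset.card (Finset.filter_congr fun v _ => by rw [sympWeight_eq_offWt_add u₀ v])

open scoped Classical in
/-- Outside the box the refined distribution vanishes. [cite: CalderbankEtAl1998, §7 (ii) (printed p. 28)] -/
theorem refDist_eq_zero_of_not_mem {S : Submodule (ZMod 2) (SympVec n)} {u₀ : SympVec n} {a b c : ℕ}
    (h : n - sympWeight u₀ < a ∨ sympWeight u₀ < b + c) : refDist S u₀ a b c = 0 := by
  rw [refDist, Finset.card_eq_zero, Finset.filter_eq_empty_iff]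
  rintro v - ⟨rfl, rfl, rfl⟩
  have h1 := offWt_le u₀ v
  have h2 := sameCnt_add_otherCnt_le u₀ v
  omega

open scoped Classical in
/-- `refDist(0,0,0) = 1`: only the zero word has `a = b = c = 0`. [cite: CalderbankEtAl1998, §7 (ii) (printed p. 28)] -/
theorem refDist_zero (S : Submodule (ZMod 2) (SympVec n)) (u₀ : SympVec n) : refDist S u₀ 0 0 0 = 1 := by
  rw [refDist, Finset.card_eq_one]
  refine ⟨0, ?_⟩
  ext v
  simp only [mem_filter, mem_codeWords, mem_singleton]
  constructor
  · rintro ⟨_, ha, hb, hc⟩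
    have hw : sympWeight v = 0 := by rw [sympWeight_eq_offWt_add u₀ v, ha, hb, hc]
    exact (sympWeight_eq_zero_iff v).1 hw
  · rintro rfl
    refine ⟨S.zero_mem, ?_⟩
    have hw := sympWeight_eq_offWt_add u₀ (0 : SympVec n)
    rw [(sympWeight_eq_zero_iff _).2 rfl] at hw
    omega

open scoped Classical in
/-- `refDist(0, w₀, 0) = 1` when `u₀ ∈ C`: a word agreeing with `u₀` on its whole support and vanishing off it IS
`u₀`. [cite: CalderbankEtAl1998, §7 (ii) (printed p. 28)] -/
theorem refDist_self {S : Submodule (ZMod 2) (SympVec n)} {u₀ : SympVec n} (hu₀ : u₀ ∈ S) :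
    refDist S u₀ 0 (sympWeight u₀) 0 = 1 := by
  rw [refDist, Finset.card_eq_one]
  refine ⟨u₀, ?_⟩
  have hsame : ∀ v : SympVec n, offWt u₀ v = 0 → sameCnt u₀ v = sympWeight u₀ → otherCnt u₀ v = 0 → v = u₀ := by
    intro v ha hb hc
    -- every coordinate: off support `vᵢ = 0 = (u₀)ᵢ`; on support `vᵢ = (u₀)ᵢ`
    have hoff : ∀ i, letters n u₀ i = 0 → letters n v i = 0 := by
      intro i hi
      by_contra hv
      have : 0 < offWt u₀ v := by
        unfold offWt; exact Finset.card_pos.2 ⟨i, mem_filter.2 ⟨mem_univ _, hi, hv⟩⟩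
      omega
    have hon : ∀ i, letters n u₀ i ≠ 0 → letters n v i = letters n u₀ i := by
      intro i hi
      by_contra hv
      have hpart := card_onZero_add u₀ v
      by_cases hv0 : letters n v i = 0
      · have : 0 < #{i | letters n u₀ i ≠ 0 ∧ letters n v i = 0} :=
          Finset.card_pos.2 ⟨i, mem_filter.2 ⟨mem_univ _, hi, hv0⟩⟩
        omega
      · have : 0 < otherCnt u₀ v := by
          unfold otherCnt; exact Finset.card_pos.2 ⟨i, mem_filter.2 ⟨mem_univ _, hi, hv0, hv⟩⟩
        omega
    apply (letters n).injective
    funext i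
    by_cases hi : letters n u₀ i = 0
    · rw [hoff i hi, hi]
    · exact hon i hi
  ext v
  simp only [mem_filter, mem_codeWords, mem_singleton]
  constructor
  · rintro ⟨_, ha, hb, hc⟩; exact hsame v ha hb hc
  · intro hv
    rw [hv]
    refine ⟨hu₀, ?_, ?_, ?_⟩
    · unfold offWt; rw [Finset.card_eq_zero, Finset.filter_eq_empty_iff]; intro i _ ⟨h0, h1⟩; exact h1 h0
    · unfold sameCnt; rw [← card_filter_letters_ne_zero u₀]
      exact congrArg Finset.card (Finset.filter_congr fun i _ => by simp)
    · unfold otherCnt; rw [Finset.card_eq_zero, Finset.filter_eq_empty_iff]; intro i _ ⟨_, _, h⟩; exact h rfl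

open scoped Classical in
/-- **Translation symmetry**: for `u₀ ∈ C`, `v ↦ v + u₀` permutes `C` and sends `(a,b,c)` to `(a, w₀−b−c, c)`, so
`refDist(a,b,c) = refDist(a, w₀−b−c, c)` whenever `b + c ≤ w₀`.
[cite: CalderbankEtAl1998, §7 (ii) (printed p. 28: «(a(u+u₀), b(u+u₀), c(u+u₀)) = (a(u), 12−b(u)−c(u), c(u))»)] -/
theorem refDist_translate {S : Submodule (ZMod 2) (SympVec n)} {u₀ : SympVec n} (hu₀ : u₀ ∈ S) {a b c : ℕ}
    (hbc : b + c ≤ sympWeight u₀) : refDist S u₀ a b c = refDist S u₀ a (sympWeight u₀ - b - c) c := by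
  unfold refDist
  refine Finset.card_bij (fun v _ => v + u₀) (fun v hv => ?_) (fun v _ v' _ h => add_right_cancel h) (fun w hw => ?_)
  · rw [mem_filter, mem_codeWords] at hv ⊢
    obtain ⟨hv, ha, hb, hc⟩ := hv
    refine ⟨S.add_mem hv hu₀, ?_, ?_, ?_⟩
    · rw [offWt_add_self, ha]
    · rw [sameCnt_add_self, hb, hc]
    · rw [otherCnt_add_self, hc]
  · rw [mem_filter, mem_codeWords] at hw
    obtain ⟨hw, ha, hb, hc⟩ := hw
    refine ⟨w + u₀, ?_, ?_⟩
    · rw [mem_filter, mem_codeWords]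
      refine ⟨S.add_mem hw hu₀, ?_, ?_, ?_⟩
      · rw [offWt_add_self, ha]
      · rw [sameCnt_add_self, hb, hc]; omega
      · rw [otherCnt_add_self, hc]
    · have h2 : u₀ + u₀ = 0 := by ext i <;> exact CharTwo.add_self_eq_zero _
      rw [add_assoc, h2, add_zero]

open scoped Classical in
/-- `c` is even on the dual when `u₀ ∈ C`: `refDist_{C⊥}(a,b,c) = 0` for odd `c` (and hence also on `C ⊆ C⊥`).
[cite: CalderbankEtAl1998, §7 (ii) (printed p. 28: «c(u) ≡ 0 (mod 2)»)] -/
theorem refDist_sympDual_eq_zero_of_odd {S : Submodule (ZMod 2) (SympVec n)} {u₀ : SympVec n} (hu₀ : u₀ ∈ S)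
    {a b c : ℕ} (hc : Odd c) : refDist (sympDual S) u₀ a b c = 0 := by
  rw [refDist, Finset.card_eq_zero, Finset.filter_eq_empty_iff]
  rintro v hv ⟨-, -, rfl⟩
  have hv' := mem_codeWords.1 hv
  rw [mem_sympDual_iff] at hv'
  have h0 : sympInner v u₀ = 0 := by rw [sympInner_comm]; exact hv' u₀ hu₀
  exact (Nat.not_even_iff_odd.2 hc) (otherCnt_even_of_sympInner_eq_zero h0)

open scoped Classical in
/-- `refDist_C ≤ refDist_{C⊥}` entrywise for a self-orthogonal `S̄` (`C ⊆ C⊥`).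
[cite: CalderbankEtAl1998, §7 Thm. 21 eq. (19) with §7 (ii) (printed pp. 26, 28)] -/
theorem refDist_le_refDist_sympDual {S : Submodule (ZMod 2) (SympVec n)} (hS : IsSelfOrthogonal S)
    (u₀ : SympVec n) (a b c : ℕ) : refDist S u₀ a b c ≤ refDist (sympDual S) u₀ a b c := by
  unfold refDist
  refine Finset.card_le_card fun v hv => ?_
  rw [mem_filter, mem_codeWords] at hv ⊢
  exact ⟨hS hv.1, hv.2⟩

open scoped Classical in
/-- `refDist_C = refDist_{C⊥}` on classes of weight `a + b + c < d` for an `[[n,k,d]]` additive code (every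
low-weight dual word is in `C`). [cite: CalderbankEtAl1998, §7 Thm. 21 eq. (19) with §7 (ii) (printed pp. 26, 28)] -/
theorem refDist_eq_refDist_sympDual {S : Submodule (ZMod 2) (SympVec n)} {k d : ℕ} (h : IsAdditiveCode S k d)
    (u₀ : SympVec n) {a b c : ℕ} (habc : a + b + c < d) : refDist S u₀ a b c = refDist (sympDual S) u₀ a b c := by
  unfold refDist
  congr 1; ext v
  rw [mem_filter, mem_codeWords, mem_filter, mem_codeWords]
  constructor
  · rintro ⟨hv, hw⟩; exact ⟨h.1 hv, hw⟩
  · rintro ⟨hv, ha, hb, hc⟩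
    refine ⟨?_, ha, hb, hc⟩
    by_contra hvS
    have := h.2.2.1 v hv hvS
    rw [sympWeight_eq_offWt_add u₀ v, ha, hb, hc] at this
    omega

end Literature.InformationTheory.QuantumCodes
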